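import Summits.CriticalPhenomena.PercolationContinuityZ3.Theorems.Transplant.SkelConcFaceRoute
import Summits.CriticalPhenomena.PercolationContinuityZ3.Theorems.Transplant.SkelRoom
import HarnessLib

/-!
# Kozma–Nitzan Lemma 11 over a planar skeleton — the face step's INNER ROUTE LINK BOUND (hp-8 (F) part B; port of the product's
# `BoxProdZ2ConcFaceRoute.route_of_contact` core): composition of `Skel.innerRoute_lt` (SkelConcFaceInnerRoute) with the route law
# `Skel.routeW` (SkelRouteLaw / SkelConcFaceRoute: subbox, rim excess, domination, wired first hop)

builds on p205010 (kernel theorem, internal audit signed; external expert review pending) — nothing in this file uses p205010.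
Lane `prim-bschramm`, typed by the `prim-hp-8` lineage (gen 24); helper file (`--supports stmt-CriticalPhenomena-4575 --as helper`).  NEW FILE.

For a deep near contact of a face-row level whose cube centre is `o` (the representative's inputs transported to `o`: source prism
`S = fatSeq o mₛ`, `mₛ = msel t ≤ M`, first-hop link input at scale `ℓ1` from `o`), the elongated inner advancing chain `innerWAD` rooted at
`o` (radius `L_A`, rim width `L'_A`) run under the ROUTE LAW `routeW Wt Qt S` (`Qt = innerQt … (φ o) ℓ1 ⊆ Rg`, the face step's region)
gives **`1 − ε'' < P_{Wt}(linkIn Qt S (coreT nA))`** — the probabilistic conjunct of the route branch of `SkelI.hcon_win₂` (L5.15) — from: the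
multi-step chain estimate (`hchain`, abstract: `Skel.WinAdvData.lt_real_of_advRChain`'s engine), the inner kits under the route law
(`hkitsA`, abstract: `SkelI.kitClause` at the inner windows), the centre-uniform excess radius (`hR₁`), the counting condition, and
the geometric side conditions of `SkelConcFaceInnerRoute` / `SkelConcFaceRoute`; the first hop lands on the quarter face
`macroPiece o ℓ1 (ψ ℓ1) (faceElt du.1 τ)` (`(τ : ℤ) = sgOf du`), which lies in the window over `Adv.core 0` when `ca = lev(φ o) + ℓ1`,
`cb = φ o (oth du.1) − cen x (oth du.1)`, `q' = ℓ1`.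
[cite: KozmaNitzan2024, §4 Lemma 11 (pp. 22–23), Lemma 12 (p. 24)]
-/

noncomputable section

open MeasureTheory
open scoped Classical

namespace Summit.CriticalPhenomena.PercolationContinuityZ3.Theorems

namespace Transplant

namespace Skel

open Literature.Probability.Percolation Literature.Probability.LatticeModels SimpleGraph KNLevels KNCells ChainPlanar
open Literature.Probability.Percolation.KozmaNitzan
open Literature.Probability.Percolation.KozmaNitzan.Cells (oth oth_ne eq_oth_of_ne sgOf sgOf_sign stepVec_apply_fst stepVec_apply_oth)
open Literature.Probability.Percolation.GM (HOct)
open Literature.Barriers.CriticalPhenomena (graphBall graphBall_finite mem_graphBall_self graphBall_mono)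
open BoxProdZ2 (ConcRadiiG InnerRunOK innerCtr innerρ innerCtr_fst innerCtr_oth sg_mul_sub_add)
open PlanarSkeletonConc

variable {V : Type} [DecidableEq V] {G : SimpleGraph V} [G.LocallyFinite] (Φ : PlanarSkeletonConc G)

omit [DecidableEq V] in
/-- **The first-hop landing**: the quarter face `macroPiece o ℓ1 R₀ (faceElt du.1 τ)` ((τ : ℤ) = sgOf du) lies in the window over the
planar core `Adv.core 0 q' s₁ R' du.1 (sgOf du) (innerCtr C x du ca cb) 0` when `ca = lev(φ o) + ℓ1`, `cb = φ o (oth du.1) − cen x (oth du.1)`,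
`q' = ℓ1` and `B_G(o, R₀) ⊆ B_G(o', L)`. [cite: KozmaNitzan2024, §4 Lemma 11 (p. 23: the first inner step starts at the cube)] -/
theorem macroPiece_subset_Win_innerCore_zero (C : PCells) (x : Site 2) (du : MDir) {o o' : V} {ℓ1 R₀ L : ℕ} {τ : ℤˣ}
    (hτ : (τ : ℤ) = sgOf du) {ca cb q' s₁ : ℤ} {R' : ℕ} (hca : ca = C.lev du x (Φ.φ o) + ℓ1)
    (hcb : cb = Φ.φ o (oth du.1) - C.cen x (oth du.1)) (hq' : q' = ℓ1) (hball : graphBall G o R₀ ⊆ graphBall G o' L) :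
    macroPiece Φ o ℓ1 R₀ (faceElt du.1 τ) ⊆ Φ.Win o' (Adv.core 0 q' s₁ R' du.1 (sgOf du) (innerCtr C x du ca cb) 0) L := by
  refine macroPiece_faceElt_subset_Win Φ hball fun z h1 h2 h3 => ?_
  rw [BoxProdZ2.mem_innerCore_zero]
  have hsg : sgOf du * sgOf du = 1 := by rcases sgOf_sign du with h | h <;> simp [h]
  refine ⟨?_, ?_, ?_⟩
  · rw [hca]; unfold PCells.lev; rw [h1, hτ]; linear_combination (ℓ1 : ℤ) * hsg
  · rw [hcb, hq']; linarith
  · rw [hcb, hq']; linarith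

/-- **The inner route link bound** (see the module docstring). [cite: KozmaNitzan2024, §4 Lemma 11 (pp. 22–23), Lemma 12 (p. 24)] -/
theorem innerRoute_link_lt [Countable V] {C : PCells} {x : Site 2} {du : MDir} {o : V} {L_A L'_A : ℕ} {ca cb q' s₁ : ℤ}
    {R' ℓ₀ nA Rlev N j₀ j₁ : ℕ} {Sfin : Finset V} {j : ℕ} (h : InnerRunOK C j s₁ R' ℓ₀ nA ca cb q') (hRl : Rlev + 1 ≤ R') (hj : j₁ ≤ Rlev)
    (hTne : ∀ k ≤ nA, ((innerWAD Φ C x du o L_A L'_A ca cb q' s₁ R' ℓ₀ nA Rlev N j₀ j₁ Sfin).coreT Φ k).Nonempty)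
    {p : unitInterval} (hC : Φ.toPlanarSkeleton.CylSubcritical p) {mₛ ℓ1 : ℕ} (hmℓ : mₛ ≤ ℓ1) (hℓL : fatRadius Φ hC ℓ1 ≤ L_A)
    {τ : ℤˣ} (hτ : (τ : ℤ) = sgOf du) (hca : ca = C.lev du x (Φ.φ o) + ℓ1) (hcb : cb = Φ.φ o (oth du.1) - C.cen x (oth du.1)) (hq' : q' = ℓ1)
    (hsep : C.lev du x (Φ.φ o) + mₛ < ca - (s₁ + 2 * R'))
    (hSM : ∀ z ∈ fatSeq Φ hC o mₛ, Φ.φ z ∉ C.M (x + stepVec du))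
    {w₀ : V} {R : ℕ} {Wt : Sym2 V → unitInterval} {q : unitInterval} {Rg : Finset V} (hWD : IsSubbox (winGraph G w₀ R) Wt q Rg)
    (hRg : ∀ u ∈ Rg, u ∈ graphBall G w₀ R) (hWG : ∀ e, e ∉ G.edgeSet → Wt e = 0)
    (hQ : innerQt Φ C x du o L_A s₁ R' nA ca cb q' (Φ.φ o) ℓ1 ⊆ Rg) (hQS : innerQt Φ C x du o L_A s₁ R' nA ca cb q' (Φ.φ o) ℓ1 ⊆ Sfin)
    (hQfar : innerQtPl C x du s₁ R' nA ca cb q' (Φ.φ o) ℓ1 ⊆ C.farAS x du j)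
    {Δ' : ℕ} {δ ε'' η : ℝ}
    (hchain : ∀ (Wg : Sym2 V → unitInterval) (s : Fin (nA + 1) → TStep (winGraph G o L_A)) (T' : Fin (nA + 1) → Finset V) (η : ℝ),
      (∀ i, (s i).L.o = (s 0).L.o) →
      (∀ i : Fin nA, T' (Fin.castSucc i) ⊆ (s i.succ).L.X 0) →
      (∀ i, T' i ⊆ (s i).T) →
      (∀ i, (s i).KitsAt Wg q Δ' δ) →
      η ≤ δ / 2 →
      (∀ i, (prodBernoulli Wg).real (⋃ t ∈ (s i).T \ T' i, openConn (s 0).L.o t) ≤ η) →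
      1 - δ < (prodBernoulli Wg).real (s 0).L.reachB →
        1 - ε'' < (prodBernoulli Wg).real (⋃ t ∈ T' (Fin.last nA), openConn (s 0).L.o t))
    (hcount : 1 / (1 - (q : ℝ)) ^ (Δ' * N) ≤ δ * ((Finset.Icc j₀ j₁).card : ℝ))
    (hkitsA : ∀ k ≤ nA, ∀ j' ∈ Finset.Icc j₀ j₁, ∃ (σ : SData V) (Sz : Finset V),
      SHyp (winLData Φ o L_A ((innerWAD Φ C x du o L_A L'_A ca cb q' s₁ R' ℓ₀ nA Rlev N j₀ j₁ Sfin).alo k)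
        ((innerWAD Φ C x du o L_A L'_A ca cb q' s₁ R' ℓ₀ nA Rlev N j₀ j₁ Sfin).ahi k) o Sfin) j' σ ∧ σ.N ≤ N ∧
      (1 - (q : ℝ) ^ σ.sB) ^ σ.k ≤ δ ∧
      Sz ⊆ (winLData Φ o L_A ((innerWAD Φ C x du o L_A L'_A ca cb q' s₁ R' ℓ₀ nA Rlev N j₀ j₁ Sfin).alo k)
        ((innerWAD Φ C x du o L_A L'_A ca cb q' s₁ R' ℓ₀ nA Rlev N j₀ j₁ Sfin).ahi k) o Sfin).X j' ∧
      Sz ⊆ (innerWAD Φ C x du o L_A L'_A ca cb q' s₁ R' ℓ₀ nA Rlev N j₀ j₁ Sfin).stepDR Φ k ∧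
      (∀ y ∈ σ.K, ∀ e ∈ σ.seed y, e ∉ wireSet (↑Sz : Set V)) ∧ (∀ y ∈ σ.K, σ.face y ⊆ Sz) ∧
      (∀ y ∈ σ.K, 1 - 3 * δ ≤ (prodBernoulli (routeW G Wt (innerQt Φ C x du o L_A s₁ R' nA ca cb q' (Φ.φ o) ℓ1) (fatSeq Φ hC o mₛ))).real {ω | ∃ u ∈ σ.face y,
        1 - δ < (prodBernoulli (pinW (routeW G Wt (innerQt Φ C x du o L_A s₁ R' nA ca cb q' (Φ.φ o) ℓ1) (fatSeq Φ hC o mₛ)) (wireSet (↑Sz : Set V)) ω)).real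
          (⋃ z ∈ (innerWAD Φ C x du o L_A L'_A ca cb q' s₁ R' ℓ₀ nA Rlev N j₀ j₁ Sfin).coreE Φ k,
            openConnIn (↑((innerWAD Φ C x du o L_A L'_A ca cb q' s₁ R' ℓ₀ nA Rlev N j₀ j₁ Sfin).stepDR Φ k) : Set V) u z)}))
    (hη : η ≤ δ / 2) {R₁ : ℕ}
    (hR₁ : ∀ (c' : V) (R'' : ℕ), R₁ ≤ R'' → ∀ (Rw : ℕ) (D' A' : Finset V), (∀ d ∈ D', d ∈ graphBall G c' Rw) →
      (∀ d ∈ D', ∀ d' ∈ D', Φ.φ d - Φ.φ d' ∈ box 2 (50 * C.r)) → A' ⊆ D' → (∀ a ∈ A', a ∈ graphBall G c' (2 * fatRadius Φ hC mₛ)) →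
        (bondPercolation G q).real (excess G c' R'' D' A') ≤ η)
    (hR : R₁ ≤ L_A - L'_A)
    (hlink : 1 - δ < (bondPercolation G q).real
      (linkIn (↑(fatSeq Φ hC o ℓ1)) (fatSeq Φ hC o mₛ) (macroPiece Φ o ℓ1 (fatRadius Φ hC ℓ1) (faceElt du.1 τ)))) :
    1 - ε'' < (prodBernoulli Wt).real
      (linkIn (↑(innerQt Φ C x du o L_A s₁ R' nA ca cb q' (Φ.φ o) ℓ1) : Set V) (fatSeq Φ hC o mₛ) ((innerWAD Φ C x du o L_A L'_A ca cb q' s₁ R' ℓ₀ nA Rlev N j₀ j₁ Sfin).coreT Φ nA)) := by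
  have ho : o ∈ fatSeq Φ hC o mₛ := (mem_fatSeq_iff Φ hC).2 (Skel.self_mem_cylBall Φ o mₛ _)
  -- the prisms about `o` lie in the route world `Qt`
  have hSQ : ∀ {m}, m ≤ ℓ1 → fatSeq Φ hC o m ⊆ innerQt Φ C x du o L_A s₁ R' nA ca cb q' (Φ.φ o) ℓ1 := by
    intro m hm
    refine (fatSeq_subset_Win Φ hC (graphBall_mono G o ((fatRadius_mono Φ hC hm).trans hℓL)) fun y hy => ?_).trans
      (Win_shift_box_subset_innerQt Φ ℓ1)
    exact Finset.mem_image.2 ⟨y, box_mono 2 hm hy, add_comm _ _⟩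
  have hsub : ∀ k ≤ nA, IsSubbox (winGraph G o L_A) (routeW G Wt (innerQt Φ C x du o L_A s₁ R' nA ca cb q' (Φ.φ o) ℓ1) (fatSeq Φ hC o mₛ)) q ((innerWAD Φ C x du o L_A L'_A ca cb q' s₁ R' ℓ₀ nA Rlev N j₀ j₁ Sfin).stepDR Φ k) :=
    fun k hk => isSubbox_routeW_stepDR Φ hC hWD hRg hWG hQ h hsep hk
  have hexc : ∀ k ≤ nA, (prodBernoulli (routeW G Wt (innerQt Φ C x du o L_A s₁ R' nA ca cb q' (Φ.φ o) ℓ1) (fatSeq Φ hC o mₛ))).real (⋃ z ∈ (innerWAD Φ C x du o L_A L'_A ca cb q' s₁ R' ℓ₀ nA Rlev N j₀ j₁ Sfin).Rim k, openConn o z) ≤ η :=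
    fun k hk => innerExc_routeW Φ hC hWD hRg hQ h hsep ho (hSQ hmℓ) hQfar hR₁ hR hk
  have hSF : Disjoint (fatSeq Φ hC o mₛ) ((innerWAD Φ C x du o L_A L'_A ca cb q' s₁ R' ℓ₀ nA Rlev N j₀ j₁ Sfin).coreT Φ nA) := (innerWAD_coreT_disjoint Φ h hSM).symm
  have hdom := innerDom_routeW Φ hC (Wt := Wt) ho (hSQ hmℓ) hSF
  -- the first hop from the wired prism
  have hge : ∀ u ∈ fatSeq Φ hC o ℓ1, ∀ u' ∈ fatSeq Φ hC o ℓ1, G.Adj u u' → q ≤ (routeW G Wt (innerQt Φ C x du o L_A s₁ R' nA ca cb q' (Φ.φ o) ℓ1) (fatSeq Φ hC o mₛ)) s(u, u') :=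
    fun u hu u' hu' hadj => routeW_ge G hWD hRg (hSQ le_rfl) ((hSQ le_rfl).trans hQ) hu hu' hadj
  have hone : ∀ u ∈ fatSeq Φ hC o mₛ, ∀ u' ∈ fatSeq Φ hC o mₛ, G.Adj u u' → (routeW G Wt (innerQt Φ C x du o L_A s₁ R' nA ca cb q' (Φ.φ o) ℓ1) (fatSeq Φ hC o mₛ)) s(u, u') = 1 :=
    fun u hu u' hu' hadj => routeW_eq_one G (hSQ hmℓ) hu hu' hadj
  have hsrc := wired_fatSeq_hsrc Φ hC hmℓ hge hone hlink ho subset_rfl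
  have hB₀ : macroPiece Φ o ℓ1 (fatRadius Φ hC ℓ1) (faceElt du.1 τ) ⊆
      Φ.Win o (Adv.core 0 q' s₁ R' du.1 (sgOf du) (innerCtr C x du ca cb) 0) L_A :=
    macroPiece_subset_Win_innerCore_zero Φ C x du hτ hca hcb hq' (graphBall_mono G o hℓL)
  have hfin : FinSupp (routeW G Wt (innerQt Φ C x du o L_A s₁ R' nA ca cb q' (Φ.φ o) ℓ1) (fatSeq Φ hC o mₛ)) Sfin :=
    (finSupp_routeW G Wt _ _).mono hQS
  have hDS : ∀ k ≤ nA, (innerWAD Φ C x du o L_A L'_A ca cb q' s₁ R' ℓ₀ nA Rlev N j₀ j₁ Sfin).stepDR Φ k ⊆ Sfin :=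
    fun k hk => (stepDR_subset_innerQt Φ hk (Φ.φ o) ℓ1).trans hQS
  have ho' : ∀ k ≤ nA, o ∉ (innerWAD Φ C x du o L_A L'_A ca cb q' s₁ R' ℓ₀ nA Rlev N j₀ j₁ Sfin).stepDR Φ k :=
    fun k hk hmem => Finset.disjoint_left.1 (disjoint_stepDR_of_sub_mem_box Φ h hk hsep (fatSeq_sub_mem_box Φ hC o mₛ)) ho hmem
  exact innerRoute_lt Φ h hRl hj hTne hchain hsub hfin hDS ho' (hQS (hSQ hmℓ ho)) hcount hkitsA hη hexc hB₀ hsrc subset_rfl (le_of_eq rfl)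
    |>.trans_le hdom

end Skel

end Transplant

end Summit.CriticalPhenomena.PercolationContinuityZ3.Theorems

end
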